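import Summits.HodgeConjecture.HodgeConjecture.Theses.CyclicUnitaryPowers
import Literature.AlgebraicGeometry.Motives.FermatHypersurface
import Literature.AlgebraicGeometry.Motives.CurveNet
import Literature.AlgebraicGeometry.Motives.HodgeTensorFactsHolds
import Literature.AlgebraicGeometry.Motives.ProjectiveSpaceCoordinateEmbedding
import Literature.AlgebraicGeometry.Motives.VarietiesProjectiveSpaceProofs
import Literature.AlgebraicGeometry.Motives.VarietiesGeometricallyIntegralProofs
import Literature.AlgebraicGeometry.HodgeTheory.HodgeFiltrationModelsReductionProofs
import Literature.AlgebraicGeometry.HodgeTheory.ComplexConjugationHolds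
import Literature.AlgebraicGeometry.HodgeTheory.DiagonalSymmetry
import Literature.AlgebraicGeometry.HodgeTheory.BettiUniverseIsoTransport
import Literature.AlgebraicGeometry.HodgeTheory.ClassesSupportedOnComplexification
import Literature.AlgebraicGeometry.HodgeTheory.HolomorphicBundleChernCharacterProjectiveSpace
import Literature.AlgebraicGeometry.HodgeTheory.WeilClassesCyclicPrymDimension

/-!
# `VeryGeneralDeckCommutatorsInHg` (stmt-HodgeConjecture-19544) · Negative · the registered stub
# `stub_cyclicDeckModel` fails at the degenerate member `f = 0`

Negative knowledge for the K1 line `unitary-reflection-zariski` (skeleton `63611234fe9f087b`, cell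
`hodge-nonav`, seat P3 g19) of crux `VeryGeneralDeckCommutatorsInHg` (rank 2) of route
`route-HodgeConjecture-CyclicUnitaryPowers`; landed `--supports stmt-HodgeConjecture-19544` (it closes
nothing). Prover seat `hodge-nonav-prover-A` (g0), 2026-08-27. Sorry-free, no definition, no named fact.

## What is refuted, and why

The registered stub `stub_cyclicDeckModel` (signature `HOME/p3/k1lineA-g19/sig_S_DECK.txt`, re-registered
in full by `stub-add` 2026-08-27T07:51Z) asserts, for EVERY prime `p ≥ 7` and EVERY homogeneous ternary
form `f` of degree `p` whose model `X_F = SmoothHypersurface.hypersurface F`, `F = x₃^p − f(x₀,x₁,x₂)`, is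
a smooth projective surface, that the canonical deck map `σ = diagonalAut F ha` has the route's signature
`Deck p X_F hXF σ`; clause (iv) of `Deck` says
`dim_ℂ (E_{ζ^j}(σ^*_ℂ) ∩ H^{2−q,q}(X_F)) = ehn p j q`, and `ehn p 1 0 = C(p−2, 2) ≥ 10`.

The quantifier forgets the member **`f = 0`**: then `F = x₃^p`, and `SmoothHypersurface.hypersurface F`
is the REDUCED induced structure on the closed set `V₊(x₃^p) = V₊(x₃)` (the tree's definition goes
through `zeroLocusClosed F`), i.e. the coordinate plane `V₊(x₃) ≅ ℙ²` — a smooth projective surface, so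
the hypothesis `hXF` is satisfiable (`isSmoothProjective_hypersurface_X_pow`), while
`dim_ℚ H²(X_F(ℂ); ℚ) = dim_ℚ H²(ℙ²(ℂ); ℚ) = 1 < 10`. Hence the stub is false as registered
(`not_stub_cyclicDeckModel`, instantiated at `p = 7`; every `p ≥ 7` fails identically).

## Classification and repair (for the line's lead / planner)

`stub-misstated` (degenerate case, NOT a defect of the crux): K1 itself
(`VeryGeneralDeckCommutatorsInHg`) quantifies over `f` off a countable family of proper algebraic
conditions `g i`, each non-zero at some form, so `f = 0` is excluded there by one coefficient functional;
K2-A's stubs take `Deck` as a HYPOTHESIS (vacuous at `f = 0`); the sign twin `stub_signDeckModel` is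
vacuous at `f = 0` (`V₊(0) = ℙ⁴` is no threefold, the tree's
`ne_zero_of_isSmoothProjective_hypersurface`). Minimal repaired signature: insert `f ≠ 0 →` after
`f.IsHomogeneous p →` in `stub_cyclicDeckModel` (for `f ≠ 0`, `x₃^p − f` is square-free, `X_F = V₊(F)` is
the genuine degree-`p` surface, smooth iff `V₊(f) ⊂ ℙ²` is a smooth curve, and (i)–(iv) are the
cyclic-cover statements the line intends); the composition `VeryGeneralDeckCommutatorsInHg_of` then owes
`f ≠ 0` from one extra genericity condition (e.g. `g 0 :=` the coefficient of `x₀^p`). The witness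
`f = 0` misses the repaired statement.

## Contents

* §1 `isHypersurfaceCutOutBy_X_pow_projectiveSpace` — over any field, `ℙᴺ` is cut out in `ℙᴺ⁺¹` by
  `x_{k₀}^m` (`m ≥ 1`): the coordinate embedding `skipMap k₀` (tree, Hartshorne II Ex. 3.12) is a closed
  immersion with image `V₊(x_{k₀}) = V₊(x_{k₀}^m)`; hence `ℙᴺ ≅ X_{x_{k₀}^m}`
  (`nonempty_projectiveSpace_iso_hypersurface_X_pow`, uniqueness of the reduced induced structure,
  Hartshorne II Ex. 3.11 (d)) and `X_{x_{k₀}^m}` is smooth projective of dimension `N`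
  (`isSmoothProjective_hypersurface_X_pow`).
* §2 `finrank_bettiCohomology_two_mul_le_one_of_iso_projectiveSpace` — a `ℂ`-variety isomorphic to
  `ℙᴺ` has `dim_ℚ H²ⁱ ≤ 1` (Hatcher Thm. 3.19 in the tree, transported).
* §3 `not_stub_cyclicDeckModel` — the negation of the registered signature, verbatim.

## References

* [Hartshorne1977] R. Hartshorne, Algebraic Geometry, GTM 52 (1977), II Example 3.2.6, II Ex. 3.11 (d),
  II Ex. 3.12.
* [HatcherAT2002] A. Hatcher, Algebraic Topology, CUP 2002, Thm. 3.19.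
-/

noncomputable section

namespace Summit.HodgeConjecture.HodgeConjecture.Theorems.VeryGeneralDeckCommutatorsInHg.Negative.CyclicDeckModelDegenerate

open scoped TensorProduct
open Literature.AlgebraicGeometry.Motives Literature.AlgebraicGeometry.HodgeTheory
open Literature.AlgebraicGeometry.HodgeTheory.BettiUniverse
open Literature.AlgebraicTopology.SingularHomology
open CategoryTheory AlgebraicGeometry

universe u

/-! ### §1 The thick coordinate hyperplane: `V₊(x_{k₀}^m)_red ≅ ℙᴺ` -/

/-- **`ℙᴺ` is cut out by `x_{k₀}^m` in `ℙᴺ⁺¹`** (`m ≥ 1`): `ℙᴺ_k` is reduced (integral), the coordinate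
embedding `skipMap k₀ : ℙᴺ ↪ ℙᴺ⁺¹` is a closed immersion, and its image is `V₊(x_{k₀}) = V₊(x_{k₀}^m)`
(a relevant homogeneous prime contains `x_{k₀}^m` iff it contains `x_{k₀}`).
[cite: Hartshorne1977, II Ex. 3.12] -/
theorem isHypersurfaceCutOutBy_X_pow_projectiveSpace (k : Type u) [Field k] (N : ℕ) (k₀ : Fin (N + 2))
    {m : ℕ} (hm : 0 < m) :
    IsHypersurfaceCutOutBy (N + 1) ((MvPolynomial.X k₀ : MvPolynomial (Fin (N + 2)) k) ^ m)
      (projectiveSpace N k) := by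
  letI := MvPolynomial.gradedAlgebra (σ := Fin (N + 2)) (R := k)
  haveI : IsIntegral (projectiveSpace N k).left :=
    IsSmoothProjective.isIntegral_holds (isSmoothProjective_projectiveSpace_holds k N)
  refine ⟨inferInstance, ProjectiveSpace.skipMap k₀, inferInstance, ?_⟩
  rw [ProjectiveSpectrum.zeroLocus_singleton_pow _ _ _ hm]
  exact ProjectiveSpace.range_skipMap k₀

/-- **`ℙᴺ ≅ X_{x_{k₀}^m}`** over `k`: the reduced hypersurface of `x_{k₀}^m` (the tree's
`SmoothHypersurface.hypersurface`, reduced induced structure on `V₊(x_{k₀}^m) = V₊(x_{k₀})`) is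
`k`-isomorphic to `ℙᴺ`, both being reduced closed subschemes of `ℙᴺ⁺¹` with that support.
[cite: Hartshorne1977, II Ex. 3.11 (d)] -/
theorem nonempty_projectiveSpace_iso_hypersurface_X_pow (k : Type u) [Field k] (N : ℕ)
    (k₀ : Fin (N + 2)) {m : ℕ} (hm : 0 < m) :
    Nonempty (projectiveSpace N k ≅
      SmoothHypersurface.hypersurface ((MvPolynomial.X k₀ : MvPolynomial (Fin (N + 2)) k) ^ m)) :=
  (isHypersurfaceCutOutBy_X_pow_projectiveSpace k N k₀ hm).nonempty_iso_hypersurface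

/-- **The reduced hypersurface of `x_{k₀}^m` in `ℙᴺ⁺¹` is a smooth projective `N`-fold** (it is `ℙᴺ`),
although for `m ≥ 2` the FORM `x_{k₀}^m` is singular along all of its zero set: the hypothesis
`IsSmoothProjective N (SmoothHypersurface.hypersurface F)` does not see the multiplicity of `F`.
[cite: Hartshorne1977, II Example 3.2.6] -/
theorem isSmoothProjective_hypersurface_X_pow (k : Type u) [Field k] (N : ℕ) (k₀ : Fin (N + 2))
    {m : ℕ} (hm : 0 < m) :
    IsSmoothProjective N
      (SmoothHypersurface.hypersurface ((MvPolynomial.X k₀ : MvPolynomial (Fin (N + 2)) k) ^ m)) := by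
  obtain ⟨e⟩ := nonempty_projectiveSpace_iso_hypersurface_X_pow k N k₀ hm
  exact IsSmoothProjective.of_iso e (isSmoothProjective_projectiveSpace_holds k N)

/-! ### §2 Even Betti numbers of a copy of `ℙᴺ` -/

/-- **`dim_ℚ H²ⁱ(X(ℂ); ℚ) ≤ 1` for `X ≅ ℙᴺ_ℂ`**: `(e⁻¹)^*` is a linear equivalence (`pullEquiv`),
universal coefficients `dim_ℚ H(–; ℚ) = dim_ℂ H(–; ℂ)`, and `dim_ℂ H²ⁱ(ℙᴺ(ℂ); ℂ) ≤ 1`.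
[cite: HatcherAT2002, Thm. 3.19] -/
theorem finrank_bettiCohomology_two_mul_le_one_of_iso_projectiveSpace {N : ℕ} {X : SchemeOver ℂ}
    (e : projectiveSpace N ℂ ≅ X) (i : ℕ) :
    Module.finrank ℚ (bettiCohomology X (2 * i)) ≤ 1 := by
  rw [← (pullEquiv e (2 * i)).finrank_eq, ← finrank_complexBetti_eq_finrank_bettiCohomology]
  exact finrank_complexBetti_projectiveSpace_le_one N i

/-! ### §3 The registered stub is false -/

/- The registered `let`-prefix of the route binds `Uni`/`Comm`, which the stub's body does not mention. -/
set_option linter.unusedVariables false in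
/-- **`stub_cyclicDeckModel` (K1 line `unitary-reflection-zariski`, registered 2026-08-27T07:51Z) is
FALSE as registered** — `stub-misstated`, degenerate member: at `p = 7`, `f = 0` the model
`X_F = V₊(x₃⁷)_red = V₊(x₃) ≅ ℙ²` IS a smooth projective surface, but clause (iv) of `Deck` with
`j = 1`, `q = 0` demands a `10 = C(5,2) = ehn 7 1 0`-dimensional subspace
`E_ζ(σ^*_ℂ) ∩ H^{2,0}` of the `1`-dimensional `ℂ ⊗_ℚ H²(X_F(ℂ); ℚ)`. Repaired statement: add the
hypothesis `f ≠ 0` (then `V₊(x₃^p − f)` is the genuine `p`-cyclic plane of the line); the witness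
`f = 0` misses it. The statement below is the negation of the registered signature VERBATIM.
[cite: Hartshorne1977, II Example 3.2.6 and II Ex. 3.11 (d)] -/
theorem not_stub_cyclicDeckModel : ¬ (
    open Literature.AlgebraicGeometry.Motives Literature.AlgebraicGeometry.HodgeTheory Literature.AlgebraicGeometry.HodgeTheory.BettiUniverse CategoryTheory.Limits in let pmul : List ℕ → List ℕ → List ℕ := fun a b => (List.range (a.length + b.length - 1)).map fun k => ((List.range (k + 1)).map fun i => a.getD i 0 * b.getD (k - i) 0).sum; let ehn : ℕ → ℕ → ℕ → ℕ := fun p j q => if (q + 1) * p < 3 + j then 0 else ((List.replicate 3 (List.replicate (p - 1) 1)).foldl pmul [1]).getD ((q + 1) * p - 3 - j) 0; let Deck : (p : ℕ) → (X : SchemeOver ℂ) → IsSmoothProjective 2 X → (X ⟶ X) → Prop := fun p X hX σ => pull σ 2 ^ p = 1 ∧ (∀ x y, tr hX (2 + 2) (cup X 2 2 (pull σ 2 x) (pull σ 2 y)) = tr hX (2 + 2) (cup X 2 2 x y)) ∧ Module.finrank ℚ ↥(Module.End.eigenspace (pull σ 2) 1) = 1 ∧ ∃ ζ : ℂ, IsPrimitiveRoot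 ζ p ∧ ∀ j q : ℕ, 1 ≤ j → j < p → q ≤ 2 → Module.finrank ℂ ↥(Module.End.eigenspace ((pull σ 2).baseChange ℂ) (ζ ^ j) ⊓ (hodge exists_isReal_hodgeModel_holds hX 2).piece ((2 : ℤ) - q) q) = ehn p j q; let Uni : (X : SchemeOver ℂ) → IsSmoothProjective 2 X → (X ⟶ X) → (bettiCohomology X 2 ≃ₗ[ℚ] bettiCohomology X 2) → Prop := fun X hX σ g => (∀ x, g (pull σ 2 x) = pull σ 2 (g x)) ∧ ∀ x y, tr hX (2 + 2) (cup X 2 2 (g x) (g y)) = tr hX (2 + 2) (cup X 2 2 x y); let Comm : (X : SchemeOver ℂ) → IsSmoothProjective 2 X → (X ⟶ X) → Prop := fun X hX σ => haveI := finite hX 2; haveI : HodgeTensorFacts.{0, 0} := hodgeTensorFacts_holds; ∀ g h : bettiCohomology X 2 ≃ₗ[ℚ] bettiCohomology X 2, Uni X hX σ g → Uni X hX σ h → g * h * g⁻¹ * h⁻¹ ∈ (hodge exists_isReal_hodgeModel_holds hX 2).hodgeGroup; ∀ ⦃p : ℕ⦄, p.Prime → 7 ≤ p → ∀ f : MvPolynomial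 (Fin 3) ℂ, f.IsHomogeneous p → ∀ hXF : IsSmoothProjective 2 (SmoothHypersurface.hypersurface (MvPolynomial.X (Fin.last 3) ^ p - MvPolynomial.rename Fin.castSucc f)), ∃ ha : (fun i : Fin 4 => if i = Fin.last 3 then (Units.mk0 (Complex.exp (2 * (Real.pi : ℂ) * Complex.I / (p : ℂ))) (Complex.exp_ne_zero _)) else 1) ∈ diagonalStabilizer (MvPolynomial.X (Fin.last 3) ^ p - MvPolynomial.rename Fin.castSucc f), Deck p (SmoothHypersurface.hypersurface (MvPolynomial.X (Fin.last 3) ^ p - MvPolynomial.rename Fin.castSucc f)) hXF (diagonalAut (MvPolynomial.X (Fin.last 3) ^ p - MvPolynomial.rename Fin.castSucc f) ha)) := by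
  intro h
  -- the degenerate member `f = 0` of the `7`-cyclic family: `F = x₃⁷ − 0 = x₃⁷`, `V₊(F)_red ≅ ℙ²`
  have hF : (MvPolynomial.X (Fin.last 3) ^ 7 - MvPolynomial.rename Fin.castSucc (0 : MvPolynomial (Fin 3) ℂ)
      : MvPolynomial (Fin 4) ℂ) = MvPolynomial.X (Fin.last 3) ^ 7 := by
    rw [map_zero, sub_zero]
  have hcut : IsHypersurfaceCutOutBy 3
      (MvPolynomial.X (Fin.last 3) ^ 7 - MvPolynomial.rename Fin.castSucc (0 : MvPolynomial (Fin 3) ℂ))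
      (projectiveSpace 2 ℂ) := by
    rw [hF]
    exact isHypersurfaceCutOutBy_X_pow_projectiveSpace ℂ 2 (Fin.last 3) (by norm_num)
  obtain ⟨e⟩ := hcut.nonempty_iso_hypersurface
  have hXF : IsSmoothProjective 2 (SmoothHypersurface.hypersurface
      (MvPolynomial.X (Fin.last 3) ^ 7 - MvPolynomial.rename Fin.castSucc (0 : MvPolynomial (Fin 3) ℂ))) :=
    IsSmoothProjective.of_iso e (isSmoothProjective_projectiveSpace_holds ℂ 2)
  -- clause (iv) of `Deck` at `j = 1`, `q = 0`: a `10`-dimensional subspace …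
  obtain ⟨ha, -, -, -, ζ, -, h4⟩ :=
    h Nat.prime_seven le_rfl 0 (MvPolynomial.isHomogeneous_zero _ _ _) hXF
  have h10 := h4 1 0 le_rfl (by norm_num) (Nat.zero_le _)
  -- … of the `1`-dimensional `ℂ ⊗_ℚ H²(X_F(ℂ); ℚ)`, `X_F ≅ ℙ²`
  haveI := finite hXF 2
  have hle : ∀ S : Submodule ℂ (ℂ ⊗[ℚ] bettiCohomology (SmoothHypersurface.hypersurface
      (MvPolynomial.X (Fin.last 3) ^ 7 - MvPolynomial.rename Fin.castSucc (0 : MvPolynomial (Fin 3) ℂ))) 2),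
      Module.finrank ℂ S ≤ 1 := by
    intro S
    refine (Submodule.finrank_le S).trans ?_
    rw [(ofRatClassBaseChangeEquiv hXF 2).finrank_eq, finrank_complexBetti_eq_finrank_bettiCohomology]
    exact finrank_bettiCohomology_two_mul_le_one_of_iso_projectiveSpace e 1
  exact absurd (h10.symm.trans_le (hle _)) (by decide)

end Summit.HodgeConjecture.HodgeConjecture.Theorems.VeryGeneralDeckCommutatorsInHg.Negative.CyclicDeckModelDegenerate
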